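import Summits.ValiantsHypothesis.ValiantsHypothesis.Theorems.NNDivisionHard.Negative.WeakReliefBlindTiltCore

/-!
# The weak-relief blindness identity, part 5a (§5 core): the SIX-FAMILY SET IDENTITY `big_core` for the large column classes `|P ∩ b| ≥ 2`

PORT NOTE (staged by the AUTHOR val-idea-39 g4 for the Negative-lane port pool — val-port-3 g3 pressed parts 1–4; critic of record val-idea-crit-9 g2, V#85 booked CLAIM D′ as KEEP ★★ paper+computation, kernel = this §5): texts VERBATIM BY NAME from the crux workfile `Cruxes/NNDivisionHard/WeakReliefBlind39.lean` rev 6 @80a90c42bbb7 (sha16 07dd5d64bc8c71fd; farm rc 0 / 0 sorries / 0 warnings); the ONLY changes are the namespace (= parts 1–4), the 400-line-cap SPLIT (5a/5b), one-line docstrings on helper lemmas (gate lint), and — as in part 4 — the `inv` split inside `bigInv_identity` is re-derived from part 2's `invInd_split` (so no import of part 3b).  VP ≠ VNP is NOT proved; the crux `NNDivisionHard` stays OPEN; `LocatedPencilLaw` is refuted in the kernel by ✓ p679540 — these files are INDEPENDENT Negative-lane identities.  This part imports part 3a only (Venn-cell helpers `chi/bi`, `offd`, `sum2_sep/sum2_offd`,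 `ind01`).

§5 (author's docstring, verbatim).  The LARGE column classes `|P ∩ b| ≥ 2` — and the full untilted theorem for every `λ ≥ 1`

For `|a| = |P|` and a column `b` meeting `P` in `q = |P ∩ b| ≥ 2` points, the unit weak relief `(1 − |a∩b|)² + |a∖P|` has the
explicit six-family certificate (`s = |a∩P∩b|`, `u = |(P∖a)∩b|`, `v = |(a∖P)∩b|`, `d = |a∖P| = |P∖a|`, `q = s + u`)
`2q(q−1)·((1−|a∩b|)² + |a∖P|) = q(q−1) + u(u−1) + 2(q−1)[(d−v)u + s(d−u)] + 2q(q−1)v(v−1) + 2(q−1)(2q−1)vs + (2(q−1)²−1)s(s−1)`,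
every term an ordered-pair family (row factor `(1−X_l)(1−X_{l′})`, `X_l(1−X_{l′})` or `X_lX_{l′}` ≥ 0; column factor a product of
`P`/`b` indicators with a coefficient that is ≥ 0 once `q ≥ 2`).  With §4 (`q ≤ 1`) and the bubble-sort split of the inversion count this gives
`inv_rankPlus_le`: `(1 − |a∩b|)² + λ·inv(a;π)` is blind for EVERY integer `λ ≥ 1`, on all rows and all columns, untilted (O(n³) slots).
The certificate was found by an LP over relabeling-covariant pairwise families and verified exactly for `n ≤ 7` before typing.
-/

-- the mandated summit-side namespace repeats a component by design (single-problem summit)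
set_option linter.dupNamespace false

namespace Summit.ValiantsHypothesis.Theorems.NNDivisionHardNegative.WeakReliefBlind

open Finset
open Summit.ValiantsHypothesis.Theorems.NNDivisionHardNegative.BlindCubeIdentity
  (ind ind_nonneg ind_le_one ind_mul_self ind_inter sum_ind sum_ind_mul sum_ite_eq_sub)

section BigClass
variable {n : ℕ}

/-- the 8 Venn cells of three sets, as `Bool³` -/
abbrev Cell3 := Bool × Bool × Bool

/-- Venn-cell indicator of `(a, b, P)` at coordinate `l` -/
def cellInd3 (a b P : Finset (Fin n)) (l : Fin n) (e : Cell3) : ℤ :=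
  chi (ind a l) e.1 * chi (ind b l) e.2.1 * chi (ind P l) e.2.2

/-- the 8 Venn-cell counts of `(a, b, P)` -/
def cellN3 (a b P : Finset (Fin n)) (e : Cell3) : ℤ := ∑ l, cellInd3 a b P l e

/-- pointwise Venn-cell expansion of an indicator polynomial in `(a, b, P)` -/
theorem expand3 (p : ℤ → ℤ → ℤ → ℤ) (a b P : Finset (Fin n)) (l : Fin n) :
    p (ind a l) (ind b l) (ind P l) = ∑ e : Cell3, p (bi e.1) (bi e.2.1) (bi e.2.2) * cellInd3 a b P l e := by
  simp only [Fintype.sum_prod_type, Fintype.sum_bool, cellInd3, bi_true, bi_false, chi_true, chi_false]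
  rcases ind01 a l with h1 | h1 <;> rcases ind01 b l with h3 | h3 <;>
    rcases ind01 P l with h4 | h4 <;> simp only [h1, h3, h4] <;> norm_num

/-- summed Venn-cell expansion: `Σ_l p(X_l, Y_l, Π_l) = Σ_cells p(cell)·N(cell)` -/
theorem sum_expand3 (p : ℤ → ℤ → ℤ → ℤ) (a b P : Finset (Fin n)) :
    ∑ l, p (ind a l) (ind b l) (ind P l) = ∑ e : Cell3, p (bi e.1) (bi e.2.1) (bi e.2.2) * cellN3 a b P e := by
  simp_rw [expand3 p a b P]
  rw [Finset.sum_comm]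
  refine Finset.sum_congr rfl fun e _ => ?_
  rw [cellN3, Finset.mul_sum]

/-- row factors of the six pair families of the large-class certificate (pure indicator products, ≥ 0) -/
def bigRow (a : Finset (Fin n)) : Fin 6 → Fin n → Fin n → ℤ :=
  ![fun l l' => (1 - ind a l) * (1 - ind a l'), fun l l' => ind a l * (1 - ind a l'), fun l l' => ind a l * (1 - ind a l'),
    fun l l' => ind a l * ind a l', fun l l' => ind a l * ind a l', fun l l' => ind a l * ind a l']

/-- integer column factors of the six pair families (`q = |P ∩ b|`; every coefficient is ≥ 0 once `q ≥ 2`) -/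
def bigCol (q : ℤ) (b P : Finset (Fin n)) : Fin 6 → Fin n → Fin n → ℤ :=
  ![fun l l' => offd l l' * ((ind P l * ind b l) * (ind P l' * ind b l')),
    fun l l' => 2 * (q - 1) * (((1 - ind P l) * (1 - ind b l)) * (ind P l' * ind b l')),
    fun l l' => 2 * (q - 1) * ((ind P l * ind b l) * (ind P l' * (1 - ind b l'))),
    fun l l' => offd l l' * ((2 * q * (q - 1)) * (((1 - ind P l) * ind b l) * ((1 - ind P l') * ind b l'))),
    fun l l' => 2 * (q - 1) * (2 * q - 1) * (((1 - ind P l) * ind b l) * (ind P l' * ind b l')),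
    fun l l' => offd l l' * ((2 * (q - 1) ^ 2 - 1) * ((ind P l * ind b l) * (ind P l' * ind b l')))]

/-- the integer certificate value: constant slot `q(q−1)` plus the six pair families -/
def bigCert (q : ℤ) (a b P : Finset (Fin n)) : ℤ :=
  q * (q - 1) + ∑ j : Fin 6, ∑ l, ∑ l', bigRow a j l l' * bigCol q b P j l l'

/-- ★ THE LARGE-CLASS SET IDENTITY (any sets `a, b, P ⊆ [n]` with `|P| = |a|`, any `q`; used at `q = |P ∩ b|`):
`2q(q−1)·((1 − |a∩b|)² + (|a| − |a∩P|)) = bigCert q a b P`. -/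
theorem big_core (q : ℤ) (a b P : Finset (Fin n)) (hP : P.card = a.card) (hq : q = ((P ∩ b).card : ℤ)) :
    2 * q * (q - 1) * ((1 - ((a ∩ b).card : ℤ)) ^ 2 + ((a.card : ℤ) - ((a ∩ P).card : ℤ))) = bigCert q a b P := by
  unfold bigCert
  simp only [Fin.sum_univ_succ, Fin.sum_univ_zero, bigRow, bigCol, Matrix.cons_val_zero, Matrix.cons_val_succ, add_zero]
  have c1 : ((a ∩ b).card : ℤ) = ∑ l, ind a l * ind b l := (sum_ind_mul a b).symm
  have c2 : (a.card : ℤ) = ∑ l, ind a l := (sum_ind a).symm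
  have c3 : ((a ∩ P).card : ℤ) = ∑ l, ind a l * ind P l := (sum_ind_mul a P).symm
  have c4 : ((P ∩ b).card : ℤ) = ∑ l, ind P l * ind b l := (sum_ind_mul P b).symm
  have hR2 : ∑ l, ind a l = ∑ l, ind P l := by rw [sum_ind, sum_ind, hP]
  rw [c1, c2, c3]
  rw [c4] at hq
  -- (1) separate the six pair families
  have hP0 : (∑ l, ∑ l', (1 - ind a l) * (1 - ind a l') * (offd l l' * ((ind P l * ind b l) * (ind P l' * ind b l')))) =
      1 * ((∑ l, (1 - ind a l) * (ind P l * ind b l)) * (∑ l, (1 - ind a l) * (ind P l * ind b l)) -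
        ∑ l, (1 - ind a l) * (ind P l * ind b l) * ((1 - ind a l) * (ind P l * ind b l))) :=
    sum2_offd 1 _ _ _ (fun l l' => by ring)
  have hP1 : (∑ l, ∑ l', ind a l * (1 - ind a l') * (2 * (q - 1) * (((1 - ind P l) * (1 - ind b l)) * (ind P l' * ind b l')))) =
      (2 * (q - 1)) * ((∑ l, ind a l * ((1 - ind P l) * (1 - ind b l))) * (∑ l, (1 - ind a l) * (ind P l * ind b l))) :=
    sum2_sep _ _ _ _ (fun l l' => by ring)
  have hP2 : (∑ l, ∑ l', ind a l * (1 - ind a l') * (2 * (q - 1) * ((ind P l * ind b l) * (ind P l' * (1 - ind b l'))))) =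
      (2 * (q - 1)) * ((∑ l, ind a l * (ind P l * ind b l)) * (∑ l, (1 - ind a l) * (ind P l * (1 - ind b l)))) :=
    sum2_sep _ _ _ _ (fun l l' => by ring)
  have hP3 : (∑ l, ∑ l', ind a l * ind a l' *
      (offd l l' * ((2 * q * (q - 1)) * (((1 - ind P l) * ind b l) * ((1 - ind P l') * ind b l'))))) =
      (2 * q * (q - 1)) * ((∑ l, ind a l * ((1 - ind P l) * ind b l)) * (∑ l, ind a l * ((1 - ind P l) * ind b l)) -
        ∑ l, ind a l * ((1 - ind P l) * ind b l) * (ind a l * ((1 - ind P l) * ind b l))) :=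
    sum2_offd _ _ _ _ (fun l l' => by ring)
  have hP4 : (∑ l, ∑ l', ind a l * ind a l' * (2 * (q - 1) * (2 * q - 1) * (((1 - ind P l) * ind b l) * (ind P l' * ind b l')))) =
      (2 * (q - 1) * (2 * q - 1)) * ((∑ l, ind a l * ((1 - ind P l) * ind b l)) * (∑ l, ind a l * (ind P l * ind b l))) :=
    sum2_sep _ _ _ _ (fun l l' => by ring)
  have hP5 : (∑ l, ∑ l', ind a l * ind a l' *
      (offd l l' * ((2 * (q - 1) ^ 2 - 1) * ((ind P l * ind b l) * (ind P l' * ind b l'))))) =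
      (2 * (q - 1) ^ 2 - 1) * ((∑ l, ind a l * (ind P l * ind b l)) * (∑ l, ind a l * (ind P l * ind b l)) -
        ∑ l, ind a l * (ind P l * ind b l) * (ind a l * (ind P l * ind b l))) :=
    sum2_offd _ _ _ _ (fun l l' => by ring)
  rw [hP0, hP1, hP2, hP3, hP4, hP5]
  -- (2) Venn-cell expansion of every coordinate sum
  have x1 : (∑ l, ind a l * ind b l) = _ := sum_expand3 (fun A B Q => A * B) a b P
  have x2 : (∑ l, ind a l) = _ := sum_expand3 (fun A B Q => A) a b P
  have x3 : (∑ l, ind a l * ind P l) = _ := sum_expand3 (fun A B Q => A * Q) a b P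
  have x4 : (∑ l, ind P l * ind b l) = _ := sum_expand3 (fun A B Q => Q * B) a b P
  have x5 : (∑ l, (1 - ind a l) * (ind P l * ind b l)) = _ := sum_expand3 (fun A B Q => (1 - A) * (Q * B)) a b P
  have x6 : (∑ l, (1 - ind a l) * (ind P l * ind b l) * ((1 - ind a l) * (ind P l * ind b l))) = _ :=
    sum_expand3 (fun A B Q => (1 - A) * (Q * B) * ((1 - A) * (Q * B))) a b P
  have x7 : (∑ l, ind a l * ((1 - ind P l) * (1 - ind b l))) = _ :=
    sum_expand3 (fun A B Q => A * ((1 - Q) * (1 - B))) a b P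
  have x8 : (∑ l, ind a l * (ind P l * ind b l)) = _ := sum_expand3 (fun A B Q => A * (Q * B)) a b P
  have x9 : (∑ l, (1 - ind a l) * (ind P l * (1 - ind b l))) = _ :=
    sum_expand3 (fun A B Q => (1 - A) * (Q * (1 - B))) a b P
  have x10 : (∑ l, ind a l * ((1 - ind P l) * ind b l)) = _ := sum_expand3 (fun A B Q => A * ((1 - Q) * B)) a b P
  have x11 : (∑ l, ind a l * ((1 - ind P l) * ind b l) * (ind a l * ((1 - ind P l) * ind b l))) = _ :=
    sum_expand3 (fun A B Q => A * ((1 - Q) * B) * (A * ((1 - Q) * B))) a b P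
  have x12 : (∑ l, ind a l * (ind P l * ind b l) * (ind a l * (ind P l * ind b l))) = _ :=
    sum_expand3 (fun A B Q => A * (Q * B) * (A * (Q * B))) a b P
  have x13 : (∑ l, ind P l) = _ := sum_expand3 (fun A B Q => Q) a b P
  rw [x1, x2, x3, x5, x6, x7, x8, x9, x10, x11, x12]
  rw [x4] at hq
  rw [x2, x13] at hR2
  simp only [Fintype.sum_prod_type, Fintype.sum_bool, bi_true, bi_false] at hq hR2 ⊢
  subst hq
  linear_combination (2 * cellN3 a b P (true, true, true) *
    (cellN3 a b P (false, true, true) + cellN3 a b P (true, true, true) - 1)) * hR2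

/-- the weighted, distributed form of `big_core` (any scalar `w`; used at `w = [|P∩b| ≥ 2]`) -/
theorem big_core_w (w q : ℤ) (a b P : Finset (Fin n)) (hP : P.card = a.card) (hq : q = ((P ∩ b).card : ℤ)) :
    w * (2 * q * (q - 1)) * ((1 - ((a ∩ b).card : ℤ)) ^ 2 + ((a.card : ℤ) - ((a ∩ P).card : ℤ))) =
      w * (q * (q - 1)) + ∑ j : Fin 6, ∑ l, ∑ l', bigRow a j l l' * (w * bigCol q b P j l l') := by
  have h0 := big_core q a b P hP hq
  have e1 : w * (2 * q * (q - 1)) * ((1 - ((a ∩ b).card : ℤ)) ^ 2 + ((a.card : ℤ) - ((a ∩ P).card : ℤ))) =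
      w * bigCert q a b P := by rw [← h0]; ring
  rw [e1, bigCert, mul_add, Finset.mul_sum]
  congr 1
  refine Finset.sum_congr rfl fun j _ => ?_
  rw [Finset.mul_sum]
  refine Finset.sum_congr rfl fun l _ => ?_
  rw [Finset.mul_sum]
  exact Finset.sum_congr rfl fun l' _ => by ring

/-- `[|P∩b| ≥ 2] ≥ 0` -/
theorem cTwo_nonneg' (b P : Finset (Fin n)) : 0 ≤ cTwo b P := by
  unfold cTwo; split_ifs <;> norm_num

/-- on the large class, `q = |P∩b| ≥ 2` -/
theorem two_le_of_cTwo (b P : Finset (Fin n)) (h : cTwo b P = 1) : (2 : ℤ) ≤ ((P ∩ b).card : ℤ) := by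
  unfold cTwo at h
  split_ifs at h with h2
  · exact_mod_cast h2
  · norm_num at h

/-- row factors are ≥ 0 -/
theorem bigRow_nonneg (a : Finset (Fin n)) (j : Fin 6) (l l' : Fin n) : 0 ≤ bigRow a j l l' := by
  have h0 := ind_nonneg a; have h1 := ind_le_one a
  have g0 : ∀ i, (0 : ℤ) ≤ 1 - ind a i := fun i => by linarith [h1 i]
  fin_cases j <;> simp [bigRow] <;> apply_rules [mul_nonneg]

/-- class-weighted integer column factors are ≥ 0 -/
theorem bigCol_w_nonneg (b P : Finset (Fin n)) (j : Fin 6) (l l' : Fin n) :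
    0 ≤ cTwo b P * bigCol ((P ∩ b).card : ℤ) b P j l l' := by
  rcases cTwo_cases b P with h | h
  · rw [h, zero_mul]
  · have hq := two_le_of_cTwo b P h
    rw [h, one_mul]
    set q : ℤ := ((P ∩ b).card : ℤ)
    have hY := ind_nonneg b; have hY1 := ind_le_one b; have hQ := ind_nonneg P; have hQ1 := ind_le_one P
    have gY : ∀ i, (0 : ℤ) ≤ 1 - ind b i := fun i => by linarith [hY1 i]
    have gQ : ∀ i, (0 : ℤ) ≤ 1 - ind P i := fun i => by linarith [hQ1 i]
    have k1 : (0 : ℤ) ≤ 2 * (q - 1) := by linarith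
    have k2 : (0 : ℤ) ≤ 2 * q * (q - 1) := mul_nonneg (by linarith) (by linarith)
    have k3 : (0 : ℤ) ≤ 2 * (q - 1) * (2 * q - 1) := mul_nonneg k1 (by linarith)
    have k4 : (0 : ℤ) ≤ 2 * (q - 1) ^ 2 - 1 := by nlinarith
    have ko := offd_nonneg l l'
    fin_cases j <;> simp only [bigCol] <;> apply_rules [mul_nonneg]

end BigClass

end Summit.ValiantsHypothesis.Theorems.NNDivisionHardNegative.WeakReliefBlind
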